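import Literature.Analysis.FluidPDE.RusinSverakCompactness
import Literature.Analysis.FluidPDE.NSViscosityRescaling
import Literature.Analysis.FluidPDE.SpaceTimeRescaling
import HarnessLib

/-!
# Viscosity scaling of Kato's mild solutions and of the Rusin–Šverák threshold `ρ_max`

Analysis/FluidPDE support file, definitions-free (serves the named facts of `MildSolutions.lean`
and `RusinSverakCompactness.lean`, which transcribe Rusin–Šverák, J. Funct. Anal. 260 (2011) =
arXiv:0911.0500, for every viscosity `ν > 0`, whereas the paper normalises `ν = 1`
(§1, p. 3: the system is written with unit viscosity)). The link is the elementary scaling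
`u(x, t) ↦ a u(x, a t)` (`a > 0`), which maps solutions with viscosity `ν` to solutions with
viscosity `a ν` (datum `u₀ ↦ a u₀`, force `f ↦ a² f(·, a ·)`); with `a = ν⁻¹` it is the
normalisation "`u(t,x) ↦ ν⁻¹ u(ν⁻¹ t, x)` maps viscosity `ν` to viscosity `1`" of the module
docstring of `MildSolutions.lean`, and with `a = ν` its inverse.

This file **proves**:

* `Fluid.IsMildNSSolutionFrom.timeRescale`, `Fluid.IsMildNSSolutionOn.timeRescale`,
  `Fluid.IsGlobalMildSolution.timeRescale`: covariance of the accepted duality-form mild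
  solutions (`MildSolution.lean`) under `Fluid.timeRescale a a u = a • u (a ·)`
  (`NSViscosityRescaling.lean`), viscosity `ν ↦ a ν`; the proof is the change of variables
  `τ = a σ` in the Duhamel time integrals plus `e^{(aν) τ Δ} = e^{ν (a τ) Δ}`
  (`Fluid.heatTest_mul_left`).
* `Fluid.ContinuousInLpOn.timeRescale`, `Fluid.aestronglyMeasurable_uncurry_timeRescale`,
  `Fluid.IsWeaklyDivFree.const_smul`: the Kato class `C([0,∞); L³)` + measurability is
  preserved.
* `NS.HasGlobalKatoSolution.timeRescale`, `NS.hasGlobalKatoSolution_smul_iff`: `u₀` has a global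
  Kato solution for viscosity `ν` iff `a u₀` has one for viscosity `a ν`.
* `HomSobolev.Represents.smul`, `NS.represents_complexify_smul`: the representation predicate
  `HomSobolev.Represents` (`MildSolutions.lean`) is homogeneous, `‖a g‖ = a ‖g‖`;
  `HomSobolev.Represents.unique`: the representing class of a datum is unique (so the `Ḣ^s`
  norm of a represented `L³` datum is well defined), via Mathlib's
  `ae_eq_of_integral_contDiff_smul_eq` and local integrability of represented classes
  (`HomSobolev.Represents.locallyIntegrable_toLp`).
* the **discharge** `NS.rusinSverakRhoMaxPure_eq_mul_holds` of the named fact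
  `NS.rusinSverakRhoMaxPure_eq_mul` (`MildSolutions.lean`): `ρ_max^pure(ν) = ν ρ_max^pure(1)`
  (Rusin–Šverák 2011, §1: `ρ_max` is defined for unit viscosity; the general-`ν` threshold of the
  tree is its multiple by `ν`).
* the **discharge** `NS.rusinSverakRhoMax_eq_mul_holds` of the finite-energy twin
  `NS.rusinSverakRhoMax_eq_mul` (`MildSolutions.lean`), through the covariance of the
  Fujita–Kato class (`NS.continuousInHomSobolevOn_timeRescale`,
  `NS.HasGlobalFujitaKatoSolution.timeRescale`, `MemHomSobolev.const_smul`).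
* `NS.IsMinimalBlowupDatum.inv_smul` and `NS.rusin_sverak_minimal_data_compact_iff_unit_viscosity`:
  the named fact `NS.rusin_sverak_minimal_data_compact` (`RusinSverakCompactness.lean`,
  Rusin–Šverák Cor. 4.3, stated for all `ν > 0`) is *equivalent* to its instance `ν = 1`, the
  printed normalisation.

## Mathlib / tree search

Tree: `Fluid.timeRescale` and the classical-solution version
`IsClassicalNSSolutionOn.viscosityRescale` (`NSViscosityRescaling.lean`); the space–time affine
maps `Fluid.stAffine` with `Fluid.map_stAffine_volume_restrict_preimage`
(`SpaceTimeRescaling.lean`, used for the measurability transport); nothing for mild solutions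
(`lean search 'IsMildNSSolutionOn'`: only `.mono`, Kato uniqueness files). Mathlib:
`intervalIntegral.integral_comp_mul_left`, `MeasureTheory.Lp.coeFn_smul`,
`MeasureTheory.withDensity_absolutelyContinuous'`, `ENNReal.mul_sSup`.

## References

* W. Rusin, V. Šverák, *Minimal initial data for potential Navier–Stokes singularities*,
  J. Funct. Anal. 260 (2011) 879–891 = arXiv:0911.0500, §1 (p. 3: unit viscosity, scaling
  `u₀(x) ↦ λ u₀(λ x)`, definition of `ρ_max`).
* T. Kato, *Strong `L^p`-solutions of the Navier–Stokes equation in `ℝ^m`, with applications to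
  weak solutions*, Math. Z. 187 (1984), 471–480, §1 (the class `C([0,∞); L³)`).
* T. Tao, *Localisation and compactness properties of the Navier–Stokes global regularity
  problem*, Anal. PDE 6 (2013) = arXiv:1108.1165, footnote 3 (viscosity normalisation by
  rescaling).
-/

noncomputable section

open MeasureTheory TopologicalSpace Set Function Filter Topology FourierTransform
open scoped InnerProductSpace RealInnerProductSpace ENNReal NNReal SchwartzMap

namespace Literature.Analysis.FluidPDE

section Fluid

/-! ### Mild solutions under the viscosity scaling `u ↦ a u(a ·)` -/

section Mild

variable {E : Type*} [NormedAddCommGroup E] [InnerProductSpace ℝ E] [FiniteDimensional ℝ E]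
  [MeasurableSpace E] [BorelSpace E]

/-- `e^{(aν) τ Δ} = e^{ν (a τ) Δ}`: the caloric test field for viscosity `a ν` at elapsed time
`τ` is the one for viscosity `ν` at elapsed time `a τ` (definitional, `heatTest ν φ τ =
heatFlow φ (ν τ)`; Fabes–Jones–Rivière 1972, §2). [folklore] -/
theorem heatTest_mul_left {F : Type*} [NormedAddCommGroup F] [NormedSpace ℝ F] (a ν : ℝ)
    (φ : E → F) (τ : ℝ) : heatTest (a * ν) φ τ = heatTest ν φ (a * τ) := by
  simp only [heatTest]
  congr 1
  ring

/-- A scalar multiple of a weakly divergence-free field is weakly divergence free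
(`∫ ⟪c u, ∇θ⟫ = c ∫ ⟪u, ∇θ⟫ = 0`). [folklore] -/
theorem IsWeaklyDivFree.const_smul {u : E → E} (hu : IsWeaklyDivFree u) (c : ℝ) :
    IsWeaklyDivFree (c • u) := by
  intro θ hθ
  simp only [Pi.smul_apply, real_inner_smul_left, integral_const_mul, hu θ hθ, mul_zero]

omit [FiniteDimensional ℝ E] [MeasurableSpace E] [BorelSpace E] in
/-- The convective derivative is linear in the transporting field:
`((c u)·∇)ψ = c (u·∇)ψ`. [folklore] -/
theorem convect_const_smul_left {F' : Type*} [NormedAddCommGroup F'] [InnerProductSpace ℝ F']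
    (c : ℝ) (u : E → E) (ψ : E → F') (x : E) :
    convect (c • u) ψ x = c • convect u ψ x := by
  simp only [convect, Pi.smul_apply, map_smul]

/-- **Viscosity scaling of the duality identity.** If `u` satisfies the mild (duality) identity
from the datum `u₀` with viscosity `ν` and force `f` at time `a t` (`a > 0`), then
`w = a • u(a ·)` (`Fluid.timeRescale a a u`) satisfies it from the datum `a • u₀` with viscosity
`a ν` and force `a² f(a ·)` at time `t`. Proof: every term of the identity for `w` at `t` is `a`
times the corresponding term for `u` at `a t` (substitution `τ = a σ` in the time integrals,
`e^{(aν)(t-τ)Δ} = e^{ν(at - aτ)Δ}`, bilinearity of `⟪u, (u·∇)ψ⟫`). This is the mild-solution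
form of the normalisation `ν = 1` (Rusin–Šverák 2011, §1; Tao 2013, footnote 3).
[cite: RusinSverak2011, §1 (arXiv:0911.0500 p. 3, unit viscosity)] -/
theorem IsMildNSSolutionFrom.timeRescale {ν a : ℝ} (ha : 0 < a) {f u : ℝ → E → E} {u₀ : E → E}
    {t : ℝ} (h : IsMildNSSolutionFrom ν f u₀ u (a * t)) :
    IsMildNSSolutionFrom (a * ν) (FluidPDE.timeRescale a (a ^ 2) f) (a • u₀) (FluidPDE.timeRescale a a u) t := by
  intro φ hφ hdiv
  have H := h φ hφ hdiv
  have hT : ∀ s, heatTest (a * ν) φ s = heatTest ν φ (a * s) := fun s => heatTest_mul_left a ν φ s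
  -- left-hand side
  have h1 : ∫ x, ⟪FluidPDE.timeRescale a a u t x, φ x⟫ = a * ∫ x, ⟪u (a * t) x, φ x⟫ := by
    simp only [timeRescale_apply, real_inner_smul_left, integral_const_mul]
  -- datum term
  have h2 : ∫ x, ⟪(a • u₀) x, heatTest (a * ν) φ t x⟫ =
      a * ∫ x, ⟪u₀ x, heatTest ν φ (a * t) x⟫ := by
    simp only [Pi.smul_apply, real_inner_smul_left, integral_const_mul, hT]
  -- nonlinear term
  have h3 : (fun τ => ∫ x, ⟪FluidPDE.timeRescale a a u τ x,
        convect (FluidPDE.timeRescale a a u τ) (heatTest (a * ν) φ (t - τ)) x⟫) =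
      fun τ => a ^ 2 * (fun σ => ∫ x, ⟪u σ x, convect (u σ) (heatTest ν φ (a * t - σ)) x⟫)
        (a * τ) := by
    funext τ
    have hw : FluidPDE.timeRescale a a u τ = a • u (a * τ) := by
      funext x; simp [timeRescale_apply]
    rw [hw]
    simp only [Pi.smul_apply, convect_const_smul_left, real_inner_smul_left,
      real_inner_smul_right, integral_const_mul, hT, mul_sub]
    ring
  have h3' : ∫ τ in 0..t, ∫ x, ⟪FluidPDE.timeRescale a a u τ x,
        convect (FluidPDE.timeRescale a a u τ) (heatTest (a * ν) φ (t - τ)) x⟫ =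
      a * ∫ σ in 0..a * t, ∫ x, ⟪u σ x, convect (u σ) (heatTest ν φ (a * t - σ)) x⟫ := by
    rw [h3, intervalIntegral.integral_const_mul,
      intervalIntegral.integral_comp_mul_left
        (fun σ => ∫ x, ⟪u σ x, convect (u σ) (heatTest ν φ (a * t - σ)) x⟫) ha.ne',
      mul_zero, smul_eq_mul, ← mul_assoc, pow_two, mul_assoc a a a⁻¹, mul_inv_cancel₀ ha.ne',
      mul_one]
  -- force term
  have h4 : (fun τ => ∫ x, ⟪FluidPDE.timeRescale a (a ^ 2) f τ x, heatTest (a * ν) φ (t - τ) x⟫) =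
      fun τ => a ^ 2 * (fun σ => ∫ x, ⟪f σ x, heatTest ν φ (a * t - σ) x⟫) (a * τ) := by
    funext τ
    simp only [timeRescale_apply, real_inner_smul_left, integral_const_mul, hT, mul_sub]
  have h4' : ∫ τ in 0..t, ∫ x, ⟪FluidPDE.timeRescale a (a ^ 2) f τ x, heatTest (a * ν) φ (t - τ) x⟫ =
      a * ∫ σ in 0..a * t, ∫ x, ⟪f σ x, heatTest ν φ (a * t - σ) x⟫ := by
    rw [h4, intervalIntegral.integral_const_mul,
      intervalIntegral.integral_comp_mul_left
        (fun σ => ∫ x, ⟪f σ x, heatTest ν φ (a * t - σ) x⟫) ha.ne',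
      mul_zero, smul_eq_mul, ← mul_assoc, pow_two, mul_assoc a a a⁻¹, mul_inv_cancel₀ ha.ne',
      mul_one]
  rw [h1, h2, h3', h4', H]
  ring

/-- **Viscosity scaling of mild solutions on a time set.** If `u` is a mild solution on `S` with
viscosity `ν`, datum `u₀`, force `f`, and `t ↦ a t` maps `S'` into `S` (`a > 0`), then
`a • u(a ·)` is a mild solution on `S'` with viscosity `a ν`, datum `a • u₀`, force
`a² f(a ·)` (Rusin–Šverák 2011, §1, normalisation `ν = 1`; Tao 2013, footnote 3).
[cite: RusinSverak2011, §1 (arXiv:0911.0500 p. 3, unit viscosity)] -/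
theorem IsMildNSSolutionOn.timeRescale {S S' : Set ℝ} {ν a : ℝ} (ha : 0 < a) {f u : ℝ → E → E}
    {u₀ : E → E} (h : IsMildNSSolutionOn S ν f u₀ u) (hS : MapsTo (fun t => a * t) S' S) :
    IsMildNSSolutionOn S' (a * ν) (FluidPDE.timeRescale a (a ^ 2) f) (a • u₀) (FluidPDE.timeRescale a a u) := by
  refine ⟨fun t ht => ?_, fun t ht => (h.2 (a * t) (hS ht)).timeRescale ha⟩
  have hw : FluidPDE.timeRescale a a u t = a • u (a * t) := by
    funext x; simp [timeRescale_apply]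
  rw [hw]
  exact (h.1 (a * t) (hS ht)).const_smul a

/-- **Viscosity scaling of global mild solutions**: `u` global mild with viscosity `ν` implies
`a • u(a ·)` global mild with viscosity `a ν` (`a > 0`), datum `a • u₀`, force `a² f(a ·)`
(Rusin–Šverák 2011, §1; Tao 2013, footnote 3).
[cite: RusinSverak2011, §1 (arXiv:0911.0500 p. 3, unit viscosity)] -/
theorem IsGlobalMildSolution.timeRescale {ν a : ℝ} (ha : 0 < a) {f u : ℝ → E → E} {u₀ : E → E}
    (h : IsGlobalMildSolution ν f u₀ u) :
    IsGlobalMildSolution (a * ν) (FluidPDE.timeRescale a (a ^ 2) f) (a • u₀) (FluidPDE.timeRescale a a u) :=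
  IsMildNSSolutionOn.timeRescale ha h fun _ ht => mem_Ici.2 (mul_nonneg ha.le (mem_Ici.1 ht))

end Mild

/-! ### The Kato class under the viscosity scaling -/

section KatoClass

variable {X : Type*} [MeasureSpace X] {F : Type*} [NormedAddCommGroup F] [NormedSpace ℝ F]

/-- `C(S; L^p)` is preserved by `u ↦ c • u(a ·)` when `t ↦ a t` maps `S'` into `S`:
`‖c u(a t) - c u(a t₀)‖_p = |c| ‖u(a t) - u(a t₀)‖_p → 0` (Kato 1984, §1, the class
`C([0,∞); L³)`). [folklore] -/
theorem ContinuousInLpOn.timeRescale {S S' : Set ℝ} {p : ℝ≥0∞} {u : ℝ → X → F}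
    (h : ContinuousInLpOn S p u) {a : ℝ} (c : ℝ) (hS : MapsTo (fun t => a * t) S' S) :
    ContinuousInLpOn S' p (FluidPDE.timeRescale a c u) := by
  refine ⟨fun t ht => ?_, fun t₀ ht₀ => ?_⟩
  · have hw : FluidPDE.timeRescale a c u t = c • u (a * t) := by
      funext x; simp [timeRescale_apply]
    rw [hw]
    exact (h.1 (a * t) (hS ht)).const_smul c
  · have hmap : Tendsto (fun t => a * t) (𝓝[S'] t₀) (𝓝[S] (a * t₀)) :=
      (continuous_const_mul a).continuousWithinAt.tendsto_nhdsWithin hS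
    have hlim := (h.2 (a * t₀) (hS ht₀)).comp hmap
    have heq : (fun t => eLpNorm (FluidPDE.timeRescale a c u t - FluidPDE.timeRescale a c u t₀) p volume) =
        fun t => ‖c‖ₑ * eLpNorm (u (a * t) - u (a * t₀)) p volume := by
      funext t
      have hsub : FluidPDE.timeRescale a c u t - FluidPDE.timeRescale a c u t₀ = c • (u (a * t) - u (a * t₀)) := by
        funext x; simp [timeRescale_apply, smul_sub]
      rw [hsub, eLpNorm_const_smul]
    rw [heq, ← mul_zero (‖c‖ₑ)]
    exact ENNReal.Tendsto.const_mul hlim (Or.inr enorm_ne_top)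

end KatoClass

section Measurability

variable {E : Type*} [NormedAddCommGroup E] [InnerProductSpace ℝ E] [FiniteDimensional ℝ E]
  [MeasurableSpace E] [BorelSpace E] {F : Type*} [NormedAddCommGroup F] [NormedSpace ℝ F]

/-- Space–time measurability on `(0, ∞) × E` is preserved by `u ↦ c • u(a ·)` (`a > 0`): the
map `(t, x) ↦ (a t, x)` is a quasi-measure-preserving bijection of `(0, ∞) × E`
(`Fluid.map_stAffine_volume_restrict_preimage`). [folklore] -/
theorem aestronglyMeasurable_uncurry_timeRescale {u : ℝ → E → F}
    (hu : AEStronglyMeasurable (uncurry u) (volume.restrict (Ioi (0 : ℝ) ×ˢ (univ : Set E))))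
    {a : ℝ} (ha : 0 < a) (c : ℝ) :
    AEStronglyMeasurable (uncurry (FluidPDE.timeRescale a c u))
      (volume.restrict (Ioi (0 : ℝ) ×ˢ (univ : Set E))) := by
  have hpre : stAffine a 1 0 (0 : E) ⁻¹' (Ioi (0 : ℝ) ×ˢ (univ : Set E)) = Ioi 0 ×ˢ univ := by
    ext ⟨s, y⟩
    simp [stAffine, ha]
  have hq : Measure.QuasiMeasurePreserving (stAffine a 1 0 (0 : E))
      (volume.restrict (Ioi (0 : ℝ) ×ˢ (univ : Set E)))
      (volume.restrict (Ioi (0 : ℝ) ×ˢ (univ : Set E))) := by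
    refine ⟨measurable_stAffine _ _ _ _, ?_⟩
    have hmap := map_stAffine_volume_restrict_preimage ha one_pos 0 (0 : E)
      (Ioi (0 : ℝ) ×ˢ (univ : Set E))
    rw [hpre] at hmap
    rw [hmap]
    exact Measure.smul_absolutelyContinuous
  have h2 : uncurry (FluidPDE.timeRescale a c u) = fun z => c • (uncurry u ∘ stAffine a 1 0 (0 : E)) z := by
    funext ⟨s, y⟩
    simp [timeRescale_apply, stAffine]
  rw [h2]
  exact (hu.comp_quasiMeasurePreserving hq).const_smul c

end Measurability

end Fluid

/-! ### Homogeneity of the representation predicate `HomSobolev.Represents` -/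

section Represents

variable {E F : Type*} [NormedAddCommGroup E] [InnerProductSpace ℝ E] [FiniteDimensional ℝ E]
  [MeasurableSpace E] [BorelSpace E] [NormedAddCommGroup F] [InnerProductSpace ℂ F]
  [CompleteSpace F]

omit [CompleteSpace F] in
/-- Lebesgue measure is absolutely continuous with respect to the `Ḣ^s` weight `‖ξ‖^{2s} dξ`
on a nontrivial space (the weight vanishes at most at the origin, a null set), so `volume`-a.e.
and `‖ξ‖^{2s} dξ`-a.e. statements about Fourier-side representatives agree
(Bahouri–Chemin–Danchin 2011, Prop. 1.34: `Ḣ^s ⊂ L¹_loc` on the Fourier side). [folklore] -/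
theorem volume_absolutelyContinuous_homSobolevMeasure [Nontrivial E] (s : ℝ) :
    (volume : Measure E) ≪ FunctionSpaces.homSobolevMeasure E s := by
  rw [FunctionSpaces.homSobolevMeasure]
  refine withDensity_absolutelyContinuous' (measurable_enorm.pow_const _).aemeasurable ?_
  have h0 : ∀ᵐ ξ ∂(volume : Measure E), ξ ≠ 0 := by
    rw [ae_iff]
    simp [measure_singleton]
  filter_upwards [h0] with ξ hξ
  simp [ENNReal.rpow_eq_zero_iff, hξ]

/-- The `Ḣ^s` weight measure is absolutely continuous with respect to Lebesgue measure
(Mathlib `withDensity_absolutelyContinuous`). [folklore] -/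
theorem homSobolevMeasure_absolutelyContinuous_volume (s : ℝ) :
    FunctionSpaces.homSobolevMeasure E s ≪ (volume : Measure E) := by
  rw [FunctionSpaces.homSobolevMeasure_def]
  exact withDensity_absolutelyContinuous _ _

/-- `Ḣ^s ∩ L²` is stable under scalars: `f ∈ Ḣ^s ∩ L²` implies `c • f ∈ Ḣ^s ∩ L²`
(`𝓕(c f) = c 𝓕f` in `L²`; Bahouri–Chemin–Danchin 2011, Def. 1.31). Deliberate dot-notation
extension of the tree's `MemHomSobolev`. [folklore] -/
theorem _root_.Literature.Analysis.FunctionSpaces.MemHomSobolev.const_smul {s : ℝ} {f : E → F} (hf : FunctionSpaces.MemHomSobolev s f) (c : ℂ) :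
    FunctionSpaces.MemHomSobolev s (c • f) := by
  obtain ⟨h2, hF⟩ := hf
  refine ⟨h2.const_smul c, ?_⟩
  rw [MemLp.toLp_const_smul c h2, FourierTransform.fourier_smul]
  have hae : ((c • (𝓕 (h2.toLp f) : Lp F 2 (volume : Measure E)) : Lp F 2 (volume : Measure E)) :
      E → F) =ᵐ[FunctionSpaces.homSobolevMeasure E s] c • ⇑(𝓕 (h2.toLp f) : Lp F 2 (volume : Measure E)) :=
    (homSobolevMeasure_absolutelyContinuous_volume s).ae_eq (Lp.coeFn_smul c _)
  exact (hF.const_smul c).ae_eq hae.symm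

section HomSobolev
open Literature.Analysis.FunctionSpaces (HomSobolev)
open Literature.Analysis.FunctionSpaces.HomSobolev

omit [CompleteSpace F] in
/-- **Homogeneity of `Represents`.** If `g ∈ Ḣ^s` represents `f`, then `c • g` represents
`c • f` for every `c ∈ ℂ` (both pairings `φ ↦ ∫ 𝓕φ • f`, `φ ↦ ∫ φ • g` are linear; the
stored class of `c • g` is `volume`-a.e. `c •` that of `g` by
`volume_absolutelyContinuous_homSobolevMeasure`). Deliberate dot-notation extension of the
tree's `HomSobolev.Represents` (Bahouri–Chemin–Danchin 2011, Def. 1.31: `Ḣ^s` is a vector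
space of tempered distributions). [folklore] -/
theorem _root_.Literature.Analysis.FunctionSpaces.HomSobolev.Represents.smul [Nontrivial E] {s : ℝ} {g : HomSobolev E F s} {f : E → F}
    (h : g.Represents f) (c : ℂ) : (c • g).Represents (c • f) := by
  have hae : (fun ξ => ((toLp s (c • g) : Lp F 2 (FunctionSpaces.homSobolevMeasure E s)) : E → F) ξ) =ᵐ[volume]
      fun ξ => c • ((toLp s g : Lp F 2 (FunctionSpaces.homSobolevMeasure E s)) : E → F) ξ := by
    have h1 : ((toLp s (c • g) : Lp F 2 (FunctionSpaces.homSobolevMeasure E s)) : E → F) =ᵐ[FunctionSpaces.homSobolevMeasure E s]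
        c • ⇑(toLp s g : Lp F 2 (FunctionSpaces.homSobolevMeasure E s)) := by
      rw [map_smul]
      exact Lp.coeFn_smul c _
    exact (volume_absolutelyContinuous_homSobolevMeasure s).ae_eq h1
  have hae' : ∀ φ : 𝓢(E, ℂ), (fun ξ => φ ξ • ((toLp s (c • g) : Lp F 2 (FunctionSpaces.homSobolevMeasure E s)) :
      E → F) ξ) =ᵐ[volume]
      fun ξ => c • (φ ξ • ((toLp s g : Lp F 2 (FunctionSpaces.homSobolevMeasure E s)) : E → F) ξ) := fun φ => by
    filter_upwards [hae] with ξ hξ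
    rw [hξ, smul_comm]
  refine ⟨fun φ => ?_, fun φ => ?_, fun φ => ?_⟩
  · have hi := (h.1 φ).smul c
    refine hi.congr (Eventually.of_forall fun x => ?_)
    simp only [Pi.smul_apply]
    exact smul_comm _ _ _
  · exact ((h.2.1 φ).smul c).congr (hae' φ).symm
  · calc ∫ x, (𝓕 φ) x • (c • f) x = ∫ x, c • ((𝓕 φ) x • f x) := by
          refine integral_congr_ae (Eventually.of_forall fun x => ?_)
          simp only [Pi.smul_apply]
          exact smul_comm _ _ _
      _ = c • ∫ ξ, φ ξ • ((toLp s g : Lp F 2 (FunctionSpaces.homSobolevMeasure E s)) : E → F) ξ := by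
          rw [integral_smul, h.2.2 φ]
      _ = ∫ ξ, c • (φ ξ • ((toLp s g : Lp F 2 (FunctionSpaces.homSobolevMeasure E s)) : E → F) ξ) :=
          (integral_smul c _).symm
      _ = ∫ ξ, φ ξ • ((toLp s (c • g) : Lp F 2 (FunctionSpaces.homSobolevMeasure E s)) : E → F) ξ :=
          integral_congr_ae (hae' φ).symm

omit [CompleteSpace F] in
/-- The Fourier-side representative of a class `g ∈ Ḣ^s` that represents some function is
locally integrable for Lebesgue measure: `Represents` demands `∫ φ • g` to converge for every
Schwartz `φ`, in particular for a smooth bump `φ ≡ 1` on a given ball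
(Bahouri–Chemin–Danchin 2011, Prop. 1.34: `Ḣ^s ⊂ 𝓢'` with `𝓕u ∈ L¹_loc` for `s < d/2`).
[folklore] -/
theorem _root_.Literature.Analysis.FunctionSpaces.HomSobolev.Represents.locallyIntegrable_toLp {s : ℝ} {g : HomSobolev E F s} {f : E → F}
    (h : g.Represents f) :
    LocallyIntegrable ((toLp s g : Lp F 2 (FunctionSpaces.homSobolevMeasure E s)) : E → F) volume := by
  intro x
  let b : ContDiffBump x := ⟨1, 2, one_pos, one_lt_two⟩
  have hb1 : HasCompactSupport (Complex.ofReal ∘ (b : E → ℝ)) :=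
    b.hasCompactSupport.comp_left Complex.ofReal_zero
  have hb2 : ContDiff ℝ ((⊤ : ℕ∞) : WithTop ℕ∞) (Complex.ofReal ∘ (b : E → ℝ)) :=
    Complex.ofRealCLM.contDiff.comp b.contDiff
  have hint := h.2.1 (hb1.toSchwartzMap hb2)
  refine ⟨Metric.closedBall x 1, Metric.closedBall_mem_nhds x one_pos, ?_⟩
  refine (hint.integrableOn (s := Metric.closedBall x 1)).congr_fun (fun ξ hξ => ?_)
    measurableSet_closedBall
  change ((Complex.ofReal ∘ (b : E → ℝ)) ξ) • _ = _
  simp [b.one_of_mem_closedBall hξ]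

/-- **Uniqueness of the representing class.** If `g, g' ∈ Ḣ^s` both represent the same
function `f`, then `g = g'`: their Fourier-side representatives have the same pairing with every
Schwartz function, hence with every real smooth compactly supported one, so they agree
Lebesgue-a.e. (Mathlib `ae_eq_of_integral_contDiff_smul_eq`, using
`Represents.locallyIntegrable_toLp`), hence `‖ξ‖^{2s} dξ`-a.e. In particular the `Ḣ^s` norm
`‖g‖` of a represented datum `f` is well defined (Bahouri–Chemin–Danchin 2011, Prop. 1.34:
`Ḣ^s ↪ 𝓢'` injectively for `s < d/2`). [folklore] -/
theorem _root_.Literature.Analysis.FunctionSpaces.HomSobolev.Represents.unique {s : ℝ} {g g' : HomSobolev E F s} {f : E → F} (hg : g.Represents f)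
    (hg' : g'.Represents f) : g = g' := by
  have hpair : ∀ φ : 𝓢(E, ℂ),
      ∫ ξ, φ ξ • ((toLp s g : Lp F 2 (FunctionSpaces.homSobolevMeasure E s)) : E → F) ξ =
        ∫ ξ, φ ξ • ((toLp s g' : Lp F 2 (FunctionSpaces.homSobolevMeasure E s)) : E → F) ξ := fun φ => by
    rw [← hg.2.2 φ, hg'.2.2 φ]
  have hae : ((toLp s g : Lp F 2 (FunctionSpaces.homSobolevMeasure E s)) : E → F) =ᵐ[volume]
      ((toLp s g' : Lp F 2 (FunctionSpaces.homSobolevMeasure E s)) : E → F) := by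
    refine ae_eq_of_integral_contDiff_smul_eq hg.locallyIntegrable_toLp
      hg'.locallyIntegrable_toLp fun θ hθ hsupp => ?_
    have h1 : HasCompactSupport (Complex.ofReal ∘ θ) := hsupp.comp_left Complex.ofReal_zero
    have h2 : ContDiff ℝ ((⊤ : ℕ∞) : WithTop ℕ∞) (Complex.ofReal ∘ θ) :=
      Complex.ofRealCLM.contDiff.comp hθ
    have h3 := hpair (h1.toSchwartzMap h2)
    have h4 : ∀ (G : E → F) (ξ : E), (h1.toSchwartzMap h2) ξ • G ξ = θ ξ • G ξ := fun G ξ => by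
      change ((Complex.ofReal ∘ θ) ξ) • G ξ = θ ξ • G ξ
      exact Complex.coe_smul _ _
    simpa only [h4] using h3
  have hae' : ((toLp s g : Lp F 2 (FunctionSpaces.homSobolevMeasure E s)) : E → F) =ᵐ[FunctionSpaces.homSobolevMeasure E s]
      ((toLp s g' : Lp F 2 (FunctionSpaces.homSobolevMeasure E s)) : E → F) := by
    exact (homSobolevMeasure_absolutelyContinuous_volume s).ae_eq hae
  exact (toLp s).injective (Lp.ext hae')

end HomSobolev

end Represents

section NS

/-- Local notation for physical space `ℝ³ = EuclideanSpace ℝ (Fin 3)`. -/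
local notation "ℝ³" => EuclideanSpace ℝ (Fin 3)

/-- Local notation for the complexified target `ℂ³ = EuclideanSpace ℂ (Fin 3)`. -/
local notation "ℂ³" => EuclideanSpace ℂ (Fin 3)

/-! ### Global Kato solutions under the viscosity scaling -/

/-- **Viscosity scaling of global Kato solutions**: if `u₀` has a global Kato solution
(`C([0,∞); L³)` mild solution) for viscosity `ν`, then `a • u₀` has one for viscosity `a ν`
(`a > 0`), namely `a • u(a ·)` (Rusin–Šverák 2011, §1, normalisation `ν = 1`; Kato 1984, §1).
[cite: RusinSverak2011, §1 (arXiv:0911.0500 p. 3, unit viscosity)] -/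
theorem HasGlobalKatoSolution.timeRescale {ν : ℝ} {u₀ : ℝ³ → ℝ³} (h : HasGlobalKatoSolution ν u₀)
    {a : ℝ} (ha : 0 < a) : HasGlobalKatoSolution (a * ν) (a • u₀) := by
  obtain ⟨u, hu, hcont, h0, hmeas⟩ := h
  refine ⟨FluidPDE.timeRescale a a u, ?_, ?_, ?_, ?_⟩
  · have h1 := IsGlobalMildSolution.timeRescale ha hu
    rwa [FluidPDE.timeRescale_zero_force] at h1
  · exact hcont.timeRescale a fun _ ht => mem_Ici.2 (mul_nonneg ha.le (mem_Ici.1 ht))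
  · funext x
    simp [FluidPDE.timeRescale_apply, h0]
  · exact FluidPDE.aestronglyMeasurable_uncurry_timeRescale hmeas ha a

/-- `a • u₀` has a global Kato solution for viscosity `a ν` iff `u₀` has one for viscosity `ν`
(`a > 0`; apply `HasGlobalKatoSolution.timeRescale` with `a` and with `a⁻¹`).
[cite: RusinSverak2011, §1 (arXiv:0911.0500 p. 3, unit viscosity)] -/
theorem hasGlobalKatoSolution_smul_iff {ν : ℝ} {u₀ : ℝ³ → ℝ³} {a : ℝ} (ha : 0 < a) :
    HasGlobalKatoSolution (a * ν) (a • u₀) ↔ HasGlobalKatoSolution ν u₀ := by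
  refine ⟨fun h => ?_, fun h => h.timeRescale ha⟩
  have h1 := h.timeRescale (inv_pos.2 ha)
  rwa [inv_smul_smul₀ ha.ne', ← mul_assoc, inv_mul_cancel₀ ha.ne', one_mul] at h1

/-! ### Real scalings of represented data -/

/-- Complexification commutes with real scalings: `complexify ∘ (a • u₀) = a • (complexify ∘ u₀)`
(with `a` acting through `ℂ`). [folklore] -/
theorem complexify_comp_smul (a : ℝ) (u₀ : ℝ³ → ℝ³) :
    FunctionSpaces.EuclideanSpace.complexify ∘ (a • u₀) = (a : ℂ) • (FunctionSpaces.EuclideanSpace.complexify ∘ u₀) := by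
  funext x
  ext i
  simp [FunctionSpaces.EuclideanSpace.complexify_apply]

/-- If `g ∈ Ḣ^{1/2}` represents the real datum `u₀` (through `complexify`), then `a • g`
represents `a • u₀`, for real `a` (`HomSobolev.Represents.smul`). [folklore] -/
theorem represents_complexify_smul {g : FunctionSpaces.HomSobolev ℝ³ ℂ³ (1 / 2 : ℝ)} {u₀ : ℝ³ → ℝ³}
    (h : g.Represents (FunctionSpaces.EuclideanSpace.complexify ∘ u₀)) (a : ℝ) :
    ((a : ℂ) • g).Represents (FunctionSpaces.EuclideanSpace.complexify ∘ (a • u₀)) := by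
  rw [complexify_comp_smul]
  exact h.smul (a : ℂ)

/-- `‖(a : ℂ)‖ₑ = a` for real `a ≥ 0`. [folklore] -/
theorem enorm_complex_ofReal_of_nonneg {a : ℝ} (ha : 0 ≤ a) : ‖(a : ℂ)‖ₑ = ENNReal.ofReal a := by
  rw [← ofReal_norm (a : ℂ), Complex.norm_real, Real.norm_of_nonneg ha]

/-- `‖a • g‖ₑ = a ‖g‖ₑ` in `Ḣ^{1/2}` for `a ≥ 0` (the `Ḣ^{1/2}` norm is a norm;
Rusin–Šverák 2011, §1). [folklore] -/
theorem enorm_real_smul_homSobolev {a : ℝ} (ha : 0 ≤ a) (g : FunctionSpaces.HomSobolev ℝ³ ℂ³ (1 / 2 : ℝ)) :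
    ‖(a : ℂ) • g‖ₑ = ENNReal.ofReal a * ‖g‖ₑ := by
  rw [enorm_smul, enorm_complex_ofReal_of_nonneg ha]

/-! ### Discharge: `ρ_max^pure(ν) = ν ρ_max^pure(1)` -/

/-- Transfer of sub-threshold radii along the viscosity scaling: if every `Ḣ^{1/2}` datum of
norm `< ρ` has a global Kato solution for viscosity `κ`, then every datum of norm `< a ρ` has
one for viscosity `a κ` (`a > 0`): scale the datum by `a⁻¹`, solve, and scale the solution back
(`HasGlobalKatoSolution.timeRescale`, `represents_complexify_smul`). This is the sentence
"`ρ_max(ν) = ν ρ_max(1)` by the scaling `u ↦ ν⁻¹ u(ν⁻¹ t, ·)`" of the docstring of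
`rusinSverakRhoMaxPure_eq_mul` (Rusin–Šverák 2011, §1).
[cite: RusinSverak2011, §1 (arXiv:0911.0500 p. 3, definition of ρ_max for unit viscosity)] -/
theorem rhoMaxPure_radius_transfer {κ a : ℝ} (ha : 0 < a) {ρ : ℝ≥0∞}
    (hρ : ∀ (u₀ : ℝ³ → ℝ³) (g : FunctionSpaces.HomSobolev ℝ³ ℂ³ (1 / 2 : ℝ)), MemLp u₀ 3 →
      g.Represents (FunctionSpaces.EuclideanSpace.complexify ∘ u₀) → FluidPDE.IsWeaklyDivFree u₀ → ‖g‖ₑ < ρ →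
      HasGlobalKatoSolution κ u₀) :
    ∀ (u₀ : ℝ³ → ℝ³) (g : FunctionSpaces.HomSobolev ℝ³ ℂ³ (1 / 2 : ℝ)), MemLp u₀ 3 →
      g.Represents (FunctionSpaces.EuclideanSpace.complexify ∘ u₀) → FluidPDE.IsWeaklyDivFree u₀ →
      ‖g‖ₑ < ENNReal.ofReal a * ρ → HasGlobalKatoSolution (a * κ) u₀ := by
  intro u₀ g hu₀ hg hdiv hlt
  have hlt' : ‖((a⁻¹ : ℝ) : ℂ) • g‖ₑ < ρ := by
    rw [enorm_real_smul_homSobolev (inv_pos.2 ha).le, ENNReal.ofReal_inv_of_pos ha, mul_comm,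
      ← div_eq_mul_inv, ENNReal.div_lt_iff (Or.inl (ENNReal.ofReal_pos.2 ha).ne')
        (Or.inl ENNReal.ofReal_ne_top), mul_comm]
    exact hlt
  have h1 : HasGlobalKatoSolution κ (a⁻¹ • u₀) :=
    hρ (a⁻¹ • u₀) (((a⁻¹ : ℝ) : ℂ) • g) (hu₀.const_smul _) (represents_complexify_smul hg a⁻¹)
      (hdiv.const_smul a⁻¹) hlt'
  have h2 := h1.timeRescale ha
  rwa [smul_inv_smul₀ ha.ne'] at h2

/-- **Discharge of `rusinSverakRhoMaxPure_eq_mul`** (`MildSolutions.lean`): the pure `Ḣ^{1/2}`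
threshold scales linearly in the viscosity, `ρ_max^pure(ν) = ν ρ_max^pure(1)` for `ν > 0`.
Proof: by `rhoMaxPure_radius_transfer` (with `a = ν`, `κ = 1`, and with `a = ν⁻¹`, `κ = ν`) the
sets of sub-threshold radii defining `ρ_max^pure(ν)` and `ρ_max^pure(1)` correspond under
`ρ ↦ ν ρ`; take suprema (`ENNReal.mul_sSup`). Rusin–Šverák work with unit viscosity (2011, §1,
p. 3); this is the bookkeeping that makes the tree's general-`ν` transcriptions
(`rusin_sverak_minimal_blowup`, `rusin_sverak_minimal_data_compact`) equivalent to the printed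
`ν = 1` statements.
[cite: RusinSverak2011, §1 (arXiv:0911.0500 p. 3, definition of ρ_max for unit viscosity)] -/
theorem rusinSverakRhoMaxPure_eq_mul_holds : rusinSverakRhoMaxPure_eq_mul := by
  intro ν hν
  unfold rusinSverakRhoMaxPure
  set S : ℝ → Set ℝ≥0∞ := fun κ => {ρ : ℝ≥0∞ | ∀ (u₀ : ℝ³ → ℝ³)
    (g : FunctionSpaces.HomSobolev ℝ³ ℂ³ (1 / 2 : ℝ)), MemLp u₀ 3 →
    g.Represents (FunctionSpaces.EuclideanSpace.complexify ∘ u₀) → FluidPDE.IsWeaklyDivFree u₀ → ‖g‖ₑ < ρ →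
    HasGlobalKatoSolution κ u₀} with hS
  have key : ∀ {κ a : ℝ}, 0 < a → ∀ ρ ∈ S κ, ENNReal.ofReal a * ρ ∈ S (a * κ) :=
    fun ha ρ hρ => rhoMaxPure_radius_transfer ha hρ
  change sSup (S ν) = ENNReal.ofReal ν * sSup (S 1)
  refine le_antisymm (sSup_le fun ρ hρ => ?_) ?_
  · have hmem : ENNReal.ofReal ν⁻¹ * ρ ∈ S 1 := by
      have h1 := key (inv_pos.2 hν) ρ hρ
      rwa [inv_mul_cancel₀ hν.ne'] at h1
    calc ρ = ENNReal.ofReal ν * (ENNReal.ofReal ν⁻¹ * ρ) := by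
          rw [← mul_assoc, ← ENNReal.ofReal_mul hν.le, mul_inv_cancel₀ hν.ne',
            ENNReal.ofReal_one, one_mul]
      _ ≤ ENNReal.ofReal ν * sSup (S 1) := by gcongr; exact le_sSup hmem
  · rw [ENNReal.mul_sSup]
    refine iSup₂_le fun ρ hρ => le_sSup ?_
    have h1 := key hν ρ hρ
    rwa [mul_one] at h1

/-! ### The Fujita–Kato class and the finite-energy threshold under the viscosity scaling -/

/-- `C(S; Ḣ^s ∩ L²)` (`Fluid.ContinuousInHomSobolevOn`) is preserved by `u ↦ c • u(a ·)`
(`c ≠ 0`) when `t ↦ a t` maps `S'` into `S`: `‖c u(a t) - c u(a t₀)‖_{Ḣ^s} =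
|c| ‖u(a t) - u(a t₀)‖_{Ḣ^s} → 0` (homogeneity `function_eHomSobolevSeminorm_const_smul` of
`CriticalSpaces.lean`; Fujita–Kato 1964, §1). [folklore] -/
theorem continuousInHomSobolevOn_timeRescale {S S' : Set ℝ} {s : ℝ} {u : ℝ → ℝ³ → ℝ³}
    (h : FluidPDE.ContinuousInHomSobolevOn S s u) {a c : ℝ} (hc : c ≠ 0)
    (hS : MapsTo (fun t => a * t) S' S) :
    FluidPDE.ContinuousInHomSobolevOn S' s (FluidPDE.timeRescale a c u) := by
  have hc' : (c : ℂ) ≠ 0 := by exact_mod_cast hc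
  refine ⟨fun t ht => ?_, fun t₀ ht₀ => ?_⟩
  · have hw : FluidPDE.timeRescale a c u t = c • u (a * t) := by
      funext x; simp [FluidPDE.timeRescale_apply]
    rw [hw, complexify_comp_smul]
    exact (h.1 (a * t) (hS ht)).const_smul (c : ℂ)
  · have hmap : Tendsto (fun t => a * t) (𝓝[S'] t₀) (𝓝[S] (a * t₀)) :=
      (continuous_const_mul a).continuousWithinAt.tendsto_nhdsWithin hS
    have hlim := (h.2 (a * t₀) (hS ht₀)).comp hmap
    have heq : (fun t => Function.eHomSobolevSeminorm s (FunctionSpaces.EuclideanSpace.complexify ∘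
        (FluidPDE.timeRescale a c u t - FluidPDE.timeRescale a c u t₀))) =
        fun t => ‖(c : ℂ)‖ₑ * Function.eHomSobolevSeminorm s
          (FunctionSpaces.EuclideanSpace.complexify ∘ (u (a * t) - u (a * t₀))) := by
      funext t
      have hsub : FluidPDE.timeRescale a c u t - FluidPDE.timeRescale a c u t₀ =
          c • (u (a * t) - u (a * t₀)) := by
        funext x; simp [FluidPDE.timeRescale_apply, smul_sub]
      rw [hsub, complexify_comp_smul, function_eHomSobolevSeminorm_const_smul s hc']
    rw [heq, ← mul_zero (‖(c : ℂ)‖ₑ)]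
    exact ENNReal.Tendsto.const_mul hlim (Or.inr enorm_ne_top)

/-- **Viscosity scaling of global Fujita–Kato solutions**: if `u₀` has a global regular
(`C([0,∞); Ḣ^{1/2} ∩ L²)`) mild solution for viscosity `ν`, then `a • u₀` has one for viscosity
`a ν` (`a > 0`), namely `a • u(a ·)` (Rusin–Šverák 2011, §1, normalisation `ν = 1`;
Fujita–Kato 1964, Thm. 1.2). [cite: RusinSverak2011, §1 (arXiv:0911.0500 p. 3, unit viscosity)] -/
theorem HasGlobalFujitaKatoSolution.timeRescale {ν : ℝ} {u₀ : ℝ³ → ℝ³}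
    (h : HasGlobalFujitaKatoSolution ν u₀) {a : ℝ} (ha : 0 < a) :
    HasGlobalFujitaKatoSolution (a * ν) (a • u₀) := by
  obtain ⟨u, hu, hH, hcont, h0, hmeas⟩ := h
  have hS : MapsTo (fun t => a * t) (Ici (0 : ℝ)) (Ici 0) := fun _ ht =>
    mem_Ici.2 (mul_nonneg ha.le (mem_Ici.1 ht))
  refine ⟨FluidPDE.timeRescale a a u, ?_, continuousInHomSobolevOn_timeRescale hH ha.ne' hS,
    hcont.timeRescale a hS, ?_, FluidPDE.aestronglyMeasurable_uncurry_timeRescale hmeas ha a⟩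
  · have h1 := IsGlobalMildSolution.timeRescale ha hu
    rwa [FluidPDE.timeRescale_zero_force] at h1
  · funext x
    simp [FluidPDE.timeRescale_apply, h0]

/-- `a • u₀` has a global Fujita–Kato solution for viscosity `a ν` iff `u₀` has one for
viscosity `ν` (`a > 0`). [cite: RusinSverak2011, §1 (arXiv:0911.0500 p. 3, unit viscosity)] -/
theorem hasGlobalFujitaKatoSolution_smul_iff {ν : ℝ} {u₀ : ℝ³ → ℝ³} {a : ℝ} (ha : 0 < a) :
    HasGlobalFujitaKatoSolution (a * ν) (a • u₀) ↔ HasGlobalFujitaKatoSolution ν u₀ := by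
  refine ⟨fun h => ?_, fun h => h.timeRescale ha⟩
  have h1 := h.timeRescale (inv_pos.2 ha)
  rwa [inv_smul_smul₀ ha.ne', ← mul_assoc, inv_mul_cancel₀ ha.ne', one_mul] at h1

/-- Transfer of sub-threshold radii for the finite-energy threshold `rusinSverakRhoMax`: if every
weakly divergence-free `u₀ ∈ Ḣ^{1/2} ∩ L²` with `‖u₀‖_{Ḣ^{1/2}} < ρ` has a global Fujita–Kato
solution for viscosity `κ`, then every such datum with `‖u₀‖_{Ḣ^{1/2}} < a ρ` has one for
viscosity `a κ` (`a > 0`; scale by `a⁻¹`, solve, scale back). Rusin–Šverák 2011, §1.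
[cite: RusinSverak2011, §1 (arXiv:0911.0500 p. 3, definition of ρ_max for unit viscosity)] -/
theorem rhoMax_radius_transfer {κ a : ℝ} (ha : 0 < a) {ρ : ℝ≥0∞}
    (hρ : ∀ u₀ : ℝ³ → ℝ³, FunctionSpaces.MemHomSobolev (1 / 2 : ℝ) (FunctionSpaces.EuclideanSpace.complexify ∘ u₀) →
      FluidPDE.IsWeaklyDivFree u₀ →
      Function.eHomSobolevSeminorm (1 / 2 : ℝ) (FunctionSpaces.EuclideanSpace.complexify ∘ u₀) < ρ →
      HasGlobalFujitaKatoSolution κ u₀) :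
    ∀ u₀ : ℝ³ → ℝ³, FunctionSpaces.MemHomSobolev (1 / 2 : ℝ) (FunctionSpaces.EuclideanSpace.complexify ∘ u₀) →
      FluidPDE.IsWeaklyDivFree u₀ →
      Function.eHomSobolevSeminorm (1 / 2 : ℝ) (FunctionSpaces.EuclideanSpace.complexify ∘ u₀) <
        ENNReal.ofReal a * ρ → HasGlobalFujitaKatoSolution (a * κ) u₀ := by
  intro u₀ hu₀ hdiv hlt
  have ha' : ((a⁻¹ : ℝ) : ℂ) ≠ 0 := by exact_mod_cast (inv_pos.2 ha).ne'
  have hmem : FunctionSpaces.MemHomSobolev (1 / 2 : ℝ) (FunctionSpaces.EuclideanSpace.complexify ∘ (a⁻¹ • u₀)) := by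
    rw [complexify_comp_smul]
    exact hu₀.const_smul _
  have hlt' : Function.eHomSobolevSeminorm (1 / 2 : ℝ) (FunctionSpaces.EuclideanSpace.complexify ∘ (a⁻¹ • u₀)) <
      ρ := by
    rw [complexify_comp_smul, function_eHomSobolevSeminorm_const_smul _ ha',
      enorm_complex_ofReal_of_nonneg (inv_pos.2 ha).le, ENNReal.ofReal_inv_of_pos ha, mul_comm,
      ← div_eq_mul_inv, ENNReal.div_lt_iff (Or.inl (ENNReal.ofReal_pos.2 ha).ne')
        (Or.inl ENNReal.ofReal_ne_top), mul_comm]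
    exact hlt
  have h1 : HasGlobalFujitaKatoSolution κ (a⁻¹ • u₀) := hρ (a⁻¹ • u₀) hmem (hdiv.const_smul a⁻¹) hlt'
  have h2 := h1.timeRescale ha
  rwa [smul_inv_smul₀ ha.ne'] at h2

/-- **Discharge of `rusinSverakRhoMax_eq_mul`** (`MildSolutions.lean`): the finite-energy
`Ḣ^{1/2}` threshold scales linearly in the viscosity, `ρ_max(ν) = ν ρ_max(1)` for `ν > 0`
(same proof as `rusinSverakRhoMaxPure_eq_mul_holds`, with `rhoMax_radius_transfer`;
Rusin–Šverák 2011, §1, normalisation `ν = 1`).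
[cite: RusinSverak2011, §1 (arXiv:0911.0500 p. 3, definition of ρ_max for unit viscosity)] -/
theorem rusinSverakRhoMax_eq_mul_holds : rusinSverakRhoMax_eq_mul := by
  intro ν hν
  unfold rusinSverakRhoMax
  set S : ℝ → Set ℝ≥0∞ := fun κ => {ρ : ℝ≥0∞ | ∀ u₀ : ℝ³ → ℝ³,
    FunctionSpaces.MemHomSobolev (1 / 2 : ℝ) (FunctionSpaces.EuclideanSpace.complexify ∘ u₀) → FluidPDE.IsWeaklyDivFree u₀ →
    Function.eHomSobolevSeminorm (1 / 2 : ℝ) (FunctionSpaces.EuclideanSpace.complexify ∘ u₀) < ρ →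
    HasGlobalFujitaKatoSolution κ u₀} with hS
  have key : ∀ {κ a : ℝ}, 0 < a → ∀ ρ ∈ S κ, ENNReal.ofReal a * ρ ∈ S (a * κ) :=
    fun ha ρ hρ => rhoMax_radius_transfer ha hρ
  change sSup (S ν) = ENNReal.ofReal ν * sSup (S 1)
  refine le_antisymm (sSup_le fun ρ hρ => ?_) ?_
  · have hmem : ENNReal.ofReal ν⁻¹ * ρ ∈ S 1 := by
      have h1 := key (inv_pos.2 hν) ρ hρ
      rwa [inv_mul_cancel₀ hν.ne'] at h1
    calc ρ = ENNReal.ofReal ν * (ENNReal.ofReal ν⁻¹ * ρ) := by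
          rw [← mul_assoc, ← ENNReal.ofReal_mul hν.le, mul_inv_cancel₀ hν.ne',
            ENNReal.ofReal_one, one_mul]
      _ ≤ ENNReal.ofReal ν * sSup (S 1) := by gcongr; exact le_sSup hmem
  · rw [ENNReal.mul_sSup]
    refine iSup₂_le fun ρ hρ => le_sSup ?_
    have h1 := key hν ρ hρ
    rwa [mul_one] at h1

/-! ### Reduction of `rusin_sverak_minimal_data_compact` to unit viscosity -/

/-- Minimal blow-up data scale with the viscosity: if `(u₀, g)` is an `Ḣ^{1/2}`-minimal blow-up
datum for viscosity `ν > 0` (`IsMinimalBlowupDatum ν`, `RusinSverakCompactness.lean`), then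
`(ν⁻¹ u₀, ν⁻¹ g)` is one for viscosity `1`: `‖ν⁻¹ g‖ = ν⁻¹ ρ_max^pure(ν) = ρ_max^pure(1)`
(`rusinSverakRhoMaxPure_eq_mul_holds`) and `ν⁻¹ u₀` has no global Kato solution for viscosity
`1` (`hasGlobalKatoSolution_smul_iff`) (Rusin–Šverák 2011, §1, normalisation `ν = 1`).
[cite: RusinSverak2011, §1 (arXiv:0911.0500 p. 3, unit viscosity)] -/
theorem IsMinimalBlowupDatum.inv_smul {ν : ℝ} (hν : 0 < ν) {u₀ : ℝ³ → ℝ³}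
    {g : FunctionSpaces.HomSobolev ℝ³ ℂ³ (1 / 2 : ℝ)} (h : IsMinimalBlowupDatum ν u₀ g) :
    IsMinimalBlowupDatum 1 (ν⁻¹ • u₀) (((ν⁻¹ : ℝ) : ℂ) • g) := by
  obtain ⟨h3, hrep, hdiv, hnorm, hblow⟩ := h
  refine ⟨h3.const_smul _, represents_complexify_smul hrep ν⁻¹, hdiv.const_smul ν⁻¹, ?_, ?_⟩
  · rw [enorm_real_smul_homSobolev (inv_pos.2 hν).le, hnorm, rusinSverakRhoMaxPure_eq_mul_holds hν,
      ← mul_assoc, ← ENNReal.ofReal_mul (inv_pos.2 hν).le, inv_mul_cancel₀ hν.ne',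
      ENNReal.ofReal_one, one_mul]
  · intro hK
    have h1 := (hasGlobalKatoSolution_smul_iff (ν := ν) (u₀ := u₀) (inv_pos.2 hν)).1
    rw [inv_mul_cancel₀ hν.ne'] at h1
    exact hblow (h1 hK)

/-- **`rusin_sverak_minimal_data_compact` is equivalent to its unit-viscosity instance**, i.e.
to the statement as printed (Rusin–Šverák 2011, Cor. 4.3 with the paper's normalisation
`ν = 1`, §1 p. 3): given minimal blow-up data for viscosity `ν`, scale them to viscosity `1`
(`IsMinimalBlowupDatum.inv_smul`), extract the scales, centres and compact family of classes
there, and scale the classes back by `ν` (the symmetries `u₀ ↦ λ u₀(λ · - x₀)` commute with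
`u₀ ↦ ν u₀`, and `y ↦ ν y` is a homeomorphism of `Ḣ^{1/2}`). This certifies that the tree's
general-`ν` transcription is not stronger than the printed statement.
[cite: RusinSverak2011, Cor. 4.3 (arXiv:0911.0500 p. 8) with §1 (p. 3, unit viscosity)] -/
theorem rusin_sverak_minimal_data_compact_iff_unit_viscosity :
    rusin_sverak_minimal_data_compact ↔
      ∀ (_hfin : rusinSverakRhoMaxPure 1 < ∞) (u₀ : ℕ → ℝ³ → ℝ³)
        (g : ℕ → FunctionSpaces.HomSobolev ℝ³ ℂ³ (1 / 2 : ℝ)),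
        (∀ k, IsMinimalBlowupDatum 1 (u₀ k) (g k)) →
        ∃ (lam : ℕ → ℝ) (x₀ : ℕ → ℝ³) (g' : ℕ → FunctionSpaces.HomSobolev ℝ³ ℂ³ (1 / 2 : ℝ)),
          (∀ k, 0 < lam k) ∧
          (∀ k, (g' k).Represents
            (FunctionSpaces.EuclideanSpace.complexify ∘ FluidPDE.rescaleData (lam k) (fun x => u₀ k (x - x₀ k)))) ∧
          IsCompact (closure (Set.range g')) := by
  refine ⟨fun h hfin u₀ g hM => h 1 one_pos hfin u₀ g hM, fun h1 => ?_⟩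
  intro ν hν hfin u₀ g hM
  have hfin1 : rusinSverakRhoMaxPure 1 < ∞ := by
    rw [rusinSverakRhoMaxPure_eq_mul_holds hν] at hfin
    refine lt_top_iff_ne_top.2 fun htop => (lt_top_iff_ne_top.1 hfin) ?_
    rw [htop, ENNReal.mul_top (ENNReal.ofReal_pos.2 hν).ne']
  obtain ⟨lam, x₀, g', hlam, hrep, hK⟩ := h1 hfin1 (fun k => ν⁻¹ • u₀ k)
    (fun k => ((ν⁻¹ : ℝ) : ℂ) • g k) fun k => (hM k).inv_smul hν
  refine ⟨lam, x₀, fun k => (ν : ℂ) • g' k, hlam, fun k => ?_, ?_⟩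
  · have hresc : FluidPDE.rescaleData (lam k) (fun x => u₀ k (x - x₀ k)) =
        ν • FluidPDE.rescaleData (lam k) (fun x => (ν⁻¹ • u₀ k) (x - x₀ k)) := by
      funext x
      simp only [FluidPDE.rescaleData, Pi.smul_apply, smul_smul]
      rw [show ν * (lam k * ν⁻¹) = lam k by field_simp]
    rw [hresc]
    exact represents_complexify_smul (hrep k) ν
  · have hK' : IsCompact ((fun y : FunctionSpaces.HomSobolev ℝ³ ℂ³ (1 / 2 : ℝ) => (ν : ℂ) • y) ''
        closure (Set.range g')) := hK.image (continuous_const_smul _)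
    refine hK'.of_isClosed_subset isClosed_closure (closure_minimal ?_ hK'.isClosed)
    rintro _ ⟨k, rfl⟩
    exact ⟨g' k, subset_closure ⟨k, rfl⟩, rfl⟩

end NS

end Literature.Analysis.FluidPDE
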